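import Literature.Probability.RandomPlanarGeometry.SLESixModulusInvariance
import Summits.CriticalPhenomena.CardyFormulaZ2.Theorems.CardyAnchoredRigidityStretchedPullbackNotTargetBlindHitsBefore
import Summits.CriticalPhenomena.CardyFormulaZ2.Theorems.CardyAnchoredRigidityStretchedPullbackNotTargetBlindRectangles

/-!
# Target independence of an anchored pullback of SLE₆ forces equal conformal moduli

Helper file for route CardyAnchoredRigidity, item stmt-CriticalPhenomena-14488
(`StretchedPullbackNotTargetBlind`).

Let `S` be a chordal family of SLE₆ laws (`IsSLELaw 6 D (S D)` for every Dobrushin domain `D`)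
with the splitting form of locality (`ChordalFamily.IsTargetIndependent`), and let
`P D := (Ψ_{D.pt 1})⁻¹_* S(Ψ_{D.pt 1} D)` be its pullback along a target-anchored field of plane
homeomorphisms `b ↦ Ψ b`. **If `P` is target independent, then for every test rectangle
`R = (bigRect; a, 0, 1, y)` the stretched rectangles `Ψ₀ R` and `Ψ₁ R` have the same conformal
modulus** (Cardy cross-ratio): `crossRatio_eq_of_targetIndependent`.

Proof. In the three-marked domain `D = (bigRect; a, 0, 1)` (targets `0` and `1`, stopping arc
`[0, 1]`) test the crossing event `E = hitsBefore [1, y] [0, 1]`, an event of the curve stopped on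
`[0, 1]` (`CurveClass.stopAt_preimage_hitsBefore`). Transporting along `Ψ₁` (`Ψ₀`), the `P`-law
towards `1` (`0`) of `E` is the SLE₆ probability in `Ψ₁ D` (`Ψ₀ D`) of the transported crossing
event; for the target `1` this is Cardy's formula in the rectangle `Ψ₁ R` (tree:
`sle_six_measureReal_hitsBefore_holds`), for the target `0` target independence OF `S` in `Ψ₀ D` moves
the target to `Ψ₀ 1` first, after which it is Cardy's formula in `Ψ₀ R`. Cardy's function is
injective on `[0, 1]` (`strictMonoOn_cardyFunction_holds`). No named facts beyond these theorems of the
tree.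
-/

noncomputable section

open Set MeasureTheory Metric Complex Filter Topology
open UpperHalfPlane (upperHalfPlaneSet)

namespace Summit.CriticalPhenomena.CardyFormulaZ2.Theorems.StretchedPullback

open Literature.Probability.RandomPlanarGeometry

/-- Transport of a crossing event by the inverse of a plane homeomorphism:
`(φ⁻¹_*)⁻¹ (hitsBefore A B) = hitsBefore (φ A) (φ B)`. -/
theorem preimage_map_symm_hitsBefore (φ : ℂ ≃ₜ ℂ) (A B : Set ℂ) :
    CurveClass.map (φ.symm : C(ℂ, ℂ)) ⁻¹' CurveClass.hitsBefore A B =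
      CurveClass.hitsBefore (φ '' A) (φ '' B) := by
  have himg : ∀ s : Set ℂ, φ.symm '' (φ '' s) = s := fun s => by
    rw [Set.image_image]; simp
  have h := preimage_curveClassMap_hitsBefore φ.symm (φ '' A) (φ '' B)
  rwa [himg, himg] at h

section Main

variable {S P : ChordalFamily} {Ψ : ℂ → ℂ ≃ₜ ℂ}

/-- **The crossing probabilities of the pullback family.** For the test domain `D = (bigRect; a, 0, 1)`
and the test event `E = hitsBefore [1,y] [0,1]`: the `P`-law towards the target `D.pt (j)` of `E`
is the `S`-law, in the image Dobrushin domain, of the transported event. -/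
theorem pullback_apply_hitsBefore
    (hP : ∀ D : DobrushinDomain,
      P D = (S (D.map (Ψ (D.pt 1)))).map (CurveClass.map ((Ψ (D.pt 1)).symm : C(ℂ, ℂ))))
    (D : DobrushinDomain) {A B : Set ℂ} (hA : IsClosed A) (hB : IsClosed B) :
    P D (CurveClass.hitsBefore A B) =
      S (D.map (Ψ (D.pt 1))) (CurveClass.hitsBefore (Ψ (D.pt 1) '' A) (Ψ (D.pt 1) '' B)) := by
  rw [hP D, Measure.map_apply (CurveClass.measurable_map _)
    (CurveClass.measurableSet_hitsBefore_holds hA hB), preimage_map_symm_hitsBefore]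

/-- **Cardy's formula in a stretched test rectangle**: for every homeomorphism `φ` of the plane and
every uniformizing datum `(ψ, x)` of `φ R`, `R = (bigRect; a, 0, 1, y)`, the `S`-probability in
`φ (bigRect; a, 1)` of the transported crossing event is `F (crossRatio x)`. -/
theorem sle_apply_hitsBefore_eq_cardy (hS : ∀ D : DobrushinDomain, IsSLELaw 6 D (S D))
    {a y : ℝ} (ha : a ∈ Ioo (-10 : ℝ) 0) (hy : y ∈ Ioo (1 : ℝ) 10) (φ : ℂ ≃ₜ ℂ)
    {ψ : ConformalEquiv upperHalfPlaneSet ((rect4 a y ha hy).map φ).carrier} {x : Fin 4 → ℝ}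
    (hψ : ((rect4 a y ha hy).map φ).IsUniformizing ψ x) :
    (S (((dom3 a ha).chord 0 2 (by decide)).map φ)).real
        (CurveClass.hitsBefore (φ '' (rect4 a y ha hy).arc 2) (φ '' (rect4 a y ha hy).arc 1)) =
      cardyFunction (crossRatio x) := by
  have hchord : ((rect4 a y ha hy).map φ).chord 0 2 (by decide) =
      ((dom3 a ha).chord 0 2 (by decide)).map φ := rfl
  have h := sle_six_measureReal_hitsBefore_holds ((rect4 a y ha hy).map φ) (hS _) hψ
  rwa [MarkedDomain.arc_map, MarkedDomain.arc_map, hchord] at h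

/-- **Target independence of the pullback forces equal moduli.** If the anchored pullback `P` of the
SLE₆ family `S` (target independent) is itself target independent, then for all test parameters
`a < 0 < 1 < y` and all uniformizing data of the stretched rectangles `Ψ₀ R`, `Ψ₁ R`
(`R = (bigRect; a, 0, 1, y)`, `Ψ₀ = Ψ 0`, `Ψ₁ = Ψ 1`) the cross-ratios agree. -/
theorem crossRatio_eq_of_targetIndependent (hS : ∀ D : DobrushinDomain, IsSLELaw 6 D (S D))
    (hTI : S.IsTargetIndependent)
    (hP : ∀ D : DobrushinDomain,
      P D = (S (D.map (Ψ (D.pt 1)))).map (CurveClass.map ((Ψ (D.pt 1)).symm : C(ℂ, ℂ))))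
    (hPTI : P.IsTargetIndependent)
    {a y : ℝ} (ha : a ∈ Ioo (-10 : ℝ) 0) (hy : y ∈ Ioo (1 : ℝ) 10)
    {ψ₀ : ConformalEquiv upperHalfPlaneSet ((rect4 a y ha hy).map (Ψ 0)).carrier} {x₀ : Fin 4 → ℝ}
    (hψ₀ : ((rect4 a y ha hy).map (Ψ 0)).IsUniformizing ψ₀ x₀)
    {ψ₁ : ConformalEquiv upperHalfPlaneSet ((rect4 a y ha hy).map (Ψ 1)).carrier} {x₁ : Fin 4 → ℝ}
    (hψ₁ : ((rect4 a y ha hy).map (Ψ 1)).IsUniformizing ψ₁ x₁) :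
    crossRatio x₀ = crossRatio x₁ := by
  set D := dom3 a ha with hD
  set R := rect4 a y ha hy with hR
  -- the test event and its measurability
  have hAc : IsClosed (R.arc 2) := R.isClosed_arc 2
  have hBc : IsClosed (R.arc 1) := R.isClosed_arc 1
  have hT : MeasurableSet (CurveClass.hitsBefore (R.arc 2) (R.arc 1)) :=
    CurveClass.measurableSet_hitsBefore_holds hAc hBc
  have harc : R.arc 1 = D.arc 1 := rect4_arc_one ha hy
  -- (1) target independence of `P` in `D`, on the test event (an event of the stopped curve)
  have key := hPTI D _ hT
  have hL1 : CurveClass.stopAt (D.arc 1) ⁻¹' CurveClass.hitsBefore (R.arc 2) (R.arc 1) =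
      CurveClass.hitsBefore (R.arc 2) (R.arc 1) := by
    rw [← harc]
    exact CurveClass.stopAt_preimage_hitsBefore hBc hBc Subset.rfl subset_union_right
  rw [hL1, pullback_apply_hitsBefore hP _ hAc hBc, pullback_apply_hitsBefore hP _ hAc hBc,
    MarkedDomain.pt_chord_one, MarkedDomain.pt_chord_one, dom3_pt_one, dom3_pt_two] at key
  -- `key : S ((D.chord 0 1).map Ψ₀) (E₀) = S ((D.chord 0 2).map Ψ₁) (E₁)`
  -- (2) target independence of `S` in `Ψ₀ D` moves the target of the left-hand side to `Ψ₀ 1`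
  have hA₀ : IsClosed (Ψ 0 '' R.arc 2) := (Ψ 0).isClosed_image.2 hAc
  have hB₀ : IsClosed (Ψ 0 '' R.arc 1) := (Ψ 0).isClosed_image.2 hBc
  have hT₀ : MeasurableSet (CurveClass.hitsBefore (Ψ 0 '' R.arc 2) (Ψ 0 '' R.arc 1)) :=
    CurveClass.measurableSet_hitsBefore_holds hA₀ hB₀
  have key₀ := hTI (D.map (Ψ 0)) _ hT₀
  have hL1₀ : CurveClass.stopAt ((D.map (Ψ 0)).arc 1) ⁻¹'
        CurveClass.hitsBefore (Ψ 0 '' R.arc 2) (Ψ 0 '' R.arc 1) =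
      CurveClass.hitsBefore (Ψ 0 '' R.arc 2) (Ψ 0 '' R.arc 1) := by
    rw [MarkedDomain.arc_map, ← harc]
    exact CurveClass.stopAt_preimage_hitsBefore hB₀ hB₀ Subset.rfl subset_union_right
  rw [hL1₀] at key₀
  have hc01 : (D.map (Ψ 0)).chord 0 1 (by decide) = (D.chord 0 1 (by decide)).map (Ψ 0) := rfl
  have hc02 : (D.map (Ψ 0)).chord 0 2 (by decide) = (D.chord 0 2 (by decide)).map (Ψ 0) := rfl
  rw [hc01, hc02] at key₀
  -- `key₀ : S ((D.chord 0 1).map Ψ₀) E₀ = S ((D.chord 0 2).map Ψ₀) E₀`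
  rw [key₀] at key
  -- (3) Cardy's formula on both sides
  have h₀ := sle_apply_hitsBefore_eq_cardy hS ha hy (Ψ 0) hψ₀
  have h₁ := sle_apply_hitsBefore_eq_cardy hS ha hy (Ψ 1) hψ₁
  rw [measureReal_def, key, ← measureReal_def, h₁] at h₀
  -- (4) injectivity of Cardy's function on `[0, 1]`
  exact (strictMonoOn_cardyFunction_holds.injOn
    (Ioo_subset_Icc_self (ConformalRectangle.crossRatio_mem_Ioo_of_isUniformizing hψ₀))
    (Ioo_subset_Icc_self (ConformalRectangle.crossRatio_mem_Ioo_of_isUniformizing hψ₁)) h₀.symm)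

end Main

end Summit.CriticalPhenomena.CardyFormulaZ2.Theorems.StretchedPullback
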